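import Mathlib
import HarnessLib
import Literature.Combinatorics.Additive.Kneser
import Literature.GroupTheory.FiniteAbelian.SubgroupsOfAllOrders
import Literature.GroupTheory.FiniteAbelian.MaximalOrderSummand

/-!
# Optimally small sumsets in finite abelian groups (Eliahou–Kervaire–Plagne 2003): the function
# `μ_G(r,s) = min_{d ∣ |G|} (⌈r/d⌉ + ⌈s/d⌉ − 1)·d`

Topic `Literature/Combinatorics/Additive`.  Cell `mm-stpp` (D-0046), seat `mm-stpp-lit` (gen 9) — the
PRINTED identity behind the "Kneser budgets" of the cell's rules U14-K
(`STPPRoomKneser.kneser_budget`, theory g9) and E3K (`STPPThreeRoomEnergy.knLB M n = min_{d∣M}(2⌈n/d⌉ − 1)d`,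
eng-2 g7; KILL-MEMO §6 T35; LIT-INDEX §8 N31), vendored and PROVED so that the size functions those rules use
have their name and their optimality in the kernel.

**Theorem (Eliahou–Kervaire–Plagne, J. Number Theory 101 (2003) 338–348; general number of summands and
arbitrary abelian groups: Plagne 2006, restated as eq. (2) on p. 379 of Plagne, Funct. Approx. 37 (2007)).**
For a finite abelian group `G` and `1 ≤ r, s ≤ |G|` let `μ_G(r,s) = min {|A + B| : A, B ⊆ G, |A| = r, |B| = s}`.
Then "`μ_G(r, s) = min_{d ∈ D} (⌈r/d⌉ + ⌈s/d⌉ − 1)·d`, where `D` is the set of integers that are the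
cardinality of a finite subgroup of `G`" (for finite abelian `G`: the set of divisors of `|G|`).

Here (all sorry-free, no named facts):
* `ekpTerm d r s = d·(⌈r/d⌉ + ⌈s/d⌉) − d` and `ekpMu n r s = min_{d ∣ n} ekpTerm d r s` (the printed function,
  `n = |G|`; `ekpMu 0 _ _ = 0`), with the bookkeeping lemmas `ekpMu_le_ekpTerm`, `exists_dvd_ekpMu_eq`, `le_ekpMu`;
* THE LOWER BOUND (EKP's Theorem via Kneser — the half the census rules use), in EVERY finite abelian group:
  `ekpTerm_card_addStab_le_card_add` (`d = |Stab(A + B)|`: `d⌈|A|/d⌉ + d⌈|B|/d⌉ − d ≤ |A + B|`, from the tree's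
  `Literature.Combinatorics.Additive.add_kneser`), `exists_dvd_ekpTerm_le_card_add`, **`ekpMu_le_card_add`**
  (`μ`-bound: `ekpMu |G| |A| |B| ≤ |A + B|`) and the difference-set form `ekpMu_le_card_sub` (`B = −A′`);
* ATTAINMENT IN THE CYCLIC GROUP `ℤ/n` (EKP's construction: `k − 1` consecutive cosets of the subgroup of order `d`
  plus part of a `k`-th coset, `k = ⌈r/d⌉`; sums of two such "coset progressions" live in `⌈r/d⌉ + ⌈s/d⌉ − 1` cosets):
  `cosetProg`, `card_cosetProg`, `cosetProg_add_cosetProg_subset`, `cosetProg_sub_cosetProg_subset`,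
  `exists_card_add_le_ekpTerm_zmod`, **`exists_card_add_eq_ekpMu_zmod`** (so `μ_{ℤ/n}(r,s) = ekpMu n r s` EXACTLY:
  lower bound for every pair + an attaining pair), and the same for ONE set and its difference set:
  `exists_card_sub_self_le_zmod` (`|S| = r`, `|S − S| ≤ (2⌈r/d⌉ − 1)d`), **`exists_card_sub_self_eq_ekpMu_zmod`**
  — i.e. the census function `knLB M n` (= `ekpMu M n n` as an arithmetic expression) is the exact minimum of
  `|S − S|` over `n`-subsets of `ℤ/M`, so no size-only input to E3K / U14-K can exceed it;
* ATTAINMENT IN EVERY FINITE ABELIAN GROUP (appended the same day; EKP's theorem in full): the SMALL SUMSETS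
  PROPERTY `exists_card_add_le_add_sub_one` / `'` (`1 ≤ r, s ≤ |G| ⇒ ∃ A B, |A| = r, |B| = s, |A + B| ≤ r + s − 1`,
  by induction on `|G|` along a surjection `G ↠ ℤ/m` — the invariant-factor decomposition of the tree's
  `Literature/GroupTheory/FiniteAbelian` — lifting small sumsets of the kernel through one coset progression plus a
  partial coset, `exists_card_add_le_of_ker`), then `exists_card_add_le_ekpTerm` (`d ∣ |G|`: a subgroup `H` of
  order `d` — converse of Lagrange, tree — and preimages of small-sumset sets of `⌈r/d⌉`, `⌈s/d⌉` cosets in `G/H`)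
  and **`exists_card_add_eq_ekpMu`**: for `1 ≤ r, s ≤ |G|` some `A, B ⊆ G` of these sizes have
  `|A + B| = ekpMu |G| r s` — with `ekpMu_le_card_add`, the printed equality `μ_G(r,s) = min_{d∣|G|}(⌈r/d⌉+⌈s/d⌉−1)d`.
* ONE SET (appended the same day): `ρ⁺_G(r) := min{|A + A| : |A| = r} = μ_G(r, r)` in every finite abelian group
  (Eliahou–Kervaire; Lee 2018 Thm 1): `exists_card_add_self_le_two_mul_sub_one` / `'` (`|A + A| ≤ 2|A| − 1` attainable),
  `exists_card_add_self_le_ekpTerm`, **`exists_card_add_self_eq_ekpMu`**; and for the DIFFERENCE function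
  `ρ⁻_G(r) := min{|A − A| : |A| = r}`: `ρ⁻ ≥ μ` always (`ekpMu_le_card_sub_self`) and `ρ⁻ = μ` in cyclic groups
  (`exists_card_sub_self_eq_ekpMu_zmod` = Lee 2018, Thm "cyclic", cf. Bajnok–Matzke 2015), and the coset-progression
  UPPER bound in any finite abelian group, subgroup form (`exists_card_sub_self_le_of_addSubgroup`: `H ≤ G`, `g` of order
  `≥ c` modulo `H`, `r ≤ c|H|` ⇒ some `r`-set has `|S − S| ≤ (2c − 1)|H|` — the construction of Lee's §3 / Thm "upper bound").
WHAT THIS FILE IS NOT: no formula for `ρ⁻_G` outside cyclic groups — it can exceed `μ_G(r,r)` (Lee 2018, Remark 2: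
`G = (ℤ/3)²`, `r = 4`: `ρ⁺ = μ = 7` but `ρ⁻ = 9`; "there is no known explicit formula for `ρ⁻_G(r)`"; exact for
`(ℤ/p)^d` by Lee's main theorem — formalised in `FewDifferencesElementaryAbelian.lean` —, conjectural in general; the
printed `D(N,e,r)` form of Lee's upper bound is `exists_card_sub_self_le_of_dvd_exponent`, appended 2026-08-27); nothing non-abelian (Eliahou–Kervaire, Europ. J.
Combin. 27 (2006) 1102–1110: in `A₄` the value `μ(6,6) = 9` is not realised with `A = B`); no statement about the
cell's census; the proof of attainment is ours in arrangement (induction along a cyclic quotient) — EKP's printed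
argument is not held (acq-13342), Plagne 2007 restates the result.

## References
* S. Eliahou, M. Kervaire, A. Plagne, *Optimally small sumsets in finite abelian groups*, J. Number Theory 101
  (2003) 338–348, doi:10.1016/s0022-314x(03)00060-x [cite: EliahouKervairePlagne2003, main Thm] (not held; the
  statement is quoted from the held restatements below).
* A. Plagne, *Optimally small sumsets in groups III*, Funct. Approx. Comment. Math. 37 (2007) 377–397 — held
  `paper:doi-10-7169-facm-1229619661`, p0003 = p. 379 eq. (2) read 2026-08-27 [cite: Plagne2007, eq. (2)].
* S. Eliahou, M. Kervaire, *The small sumsets property for solvable finite groups*, Europ. J. Combin. 27 (2006)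
  1102–1110 — held `paper:doi-10-1016-j-ejc-2006-06-004`, p. 1103 (definition of `μ_G`) read 2026-08-27.
* M. Lee, *Sets with few differences in abelian groups*, Electron. J. Combin. 25(3) (2018) P3.22,
  doi:10.37236/5502 = arXiv:1508.05524 — held `paper:arxiv-1508.05524`, p0003 (Thm 1, Remarks 1–2, Thms
  "upper bound"/"cyclic"/main, Conj. 1) and p0004 (proof of the cyclic theorem) read 2026-08-27
  [cite: Lee2018, Thm 1] [cite: Lee2018, Thm (cyclic)].
* M. Kneser, *Abschätzung der asymptotischen Dichte von Summenmengen*, Math. Z. 58 (1953) — via the tree's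
  `Literature/Combinatorics/Additive/Kneser.lean` [cite: Nathanson1996, Thm 4.3].
-/

namespace Literature.Combinatorics.Additive

open Finset
open scoped Pointwise

/-! ## The Eliahou–Kervaire–Plagne function -/

/-- `ekpTerm d r s = d·(⌈r/d⌉ + ⌈s/d⌉) − d = (⌈r/d⌉ + ⌈s/d⌉ − 1)·d` (natural-number ceilings `⌈x/d⌉ = (x + d − 1)/d`
for `0 < d`): the size of the sum of two "coset progressions" of `⌈r/d⌉` and `⌈s/d⌉` cosets of a subgroup of order
`d`. [cite: EliahouKervairePlagne2003, main Thm] [cite: Plagne2007, p. 379 eq. (2)] -/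
def ekpTerm (d r s : ℕ) : ℕ := d * ((r + d - 1) / d + (s + d - 1) / d) - d

/-- The Eliahou–Kervaire–Plagne function `μ(n; r, s) = min_{d ∣ n} (⌈r/d⌉ + ⌈s/d⌉ − 1)·d` for a group order
`n ≥ 1` (for `n = 0` we set `0`).  By EKP 2003 this is `min {|A + B| : |A| = r, |B| = s}` in every abelian group of
order `n` (`1 ≤ r, s ≤ n`); this file proves `≤ |A + B|` in every finite abelian group and equality in `ℤ/n`.
[cite: EliahouKervairePlagne2003, main Thm] [cite: Plagne2007, eq. (2)] -/
def ekpMu (n r s : ℕ) : ℕ :=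
  if h : n = 0 then 0 else (n.divisors).inf' (Nat.nonempty_divisors.2 h) (fun d => ekpTerm d r s)

/-- Unfolding of `ekpTerm` (bookkeeping for the printed formula). [cite: EliahouKervairePlagne2003, main Thm] [cite: Plagne2007, p. 379 eq. (2)] -/
theorem ekpTerm_def (d r s : ℕ) : ekpTerm d r s = d * ((r + d - 1) / d + (s + d - 1) / d) - d := rfl

/-- `ekpTerm d r s = (⌈r/d⌉ + ⌈s/d⌉ − 1)·d`, the printed shape of the summand. [cite: EliahouKervairePlagne2003, main Thm] [cite: Plagne2007, p. 379 eq. (2)] -/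
theorem ekpTerm_eq_sub_one_mul (d r s : ℕ) :
    ekpTerm d r s = ((r + d - 1) / d + (s + d - 1) / d - 1) * d := by
  rw [ekpTerm_def, Nat.sub_mul, one_mul, mul_comm]

/-- The diagonal value: `ekpTerm d r r = d·(2⌈r/d⌉) − d = (2⌈r/d⌉ − 1)·d` — the census's `knLB` summand
(bookkeeping for the printed formula). [cite: EliahouKervairePlagne2003, main Thm] [cite: Plagne2007, p. 379 eq. (2)] -/
theorem ekpTerm_self (d r : ℕ) : ekpTerm d r r = d * (2 * ((r + d - 1) / d)) - d := by
  rw [ekpTerm_def, two_mul]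

/-- Junk value at `n = 0` (bookkeeping). [cite: EliahouKervairePlagne2003, main Thm] [cite: Plagne2007, p. 379 eq. (2)] -/
theorem ekpMu_zero (r s : ℕ) : ekpMu 0 r s = 0 := by simp [ekpMu]

/-- Unfolding of `ekpMu` for `n ≥ 1`: the minimum over the divisors of `n` (bookkeeping for the printed formula).
[cite: EliahouKervairePlagne2003, main Thm] [cite: Plagne2007, p. 379 eq. (2)] -/
theorem ekpMu_of_ne_zero {n : ℕ} (hn : n ≠ 0) (r s : ℕ) :
    ekpMu n r s = (n.divisors).inf' (Nat.nonempty_divisors.2 hn) (fun d => ekpTerm d r s) := by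
  simp [ekpMu, hn]

/-- `μ(n; r, s) ≤ (⌈r/d⌉ + ⌈s/d⌉ − 1)·d` for every divisor `d` of `n ≥ 1` (bookkeeping for the printed formula).
[cite: EliahouKervairePlagne2003, main Thm] [cite: Plagne2007, p. 379 eq. (2)] -/
theorem ekpMu_le_ekpTerm {n d : ℕ} (hn : n ≠ 0) (hd : d ∣ n) (r s : ℕ) : ekpMu n r s ≤ ekpTerm d r s := by
  rw [ekpMu_of_ne_zero hn]
  exact Finset.inf'_le _ (Nat.mem_divisors.2 ⟨hd, hn⟩)

/-- The minimum is attained at some (positive) divisor (bookkeeping for the printed formula). [cite: EliahouKervairePlagne2003, main Thm] [cite: Plagne2007, p. 379 eq. (2)] -/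
theorem exists_dvd_ekpMu_eq {n : ℕ} (hn : n ≠ 0) (r s : ℕ) :
    ∃ d : ℕ, d ∣ n ∧ 0 < d ∧ ekpMu n r s = ekpTerm d r s := by
  rw [ekpMu_of_ne_zero hn]
  obtain ⟨d, hd, heq⟩ := Finset.exists_mem_eq_inf' (Nat.nonempty_divisors.2 hn) (fun d => ekpTerm d r s)
  exact ⟨d, Nat.dvd_of_mem_divisors hd, Nat.pos_of_mem_divisors hd, heq⟩

/-- To bound `μ(n; r, s)` from below it suffices to bound every term (bookkeeping for the printed formula).
[cite: EliahouKervairePlagne2003, main Thm] [cite: Plagne2007, p. 379 eq. (2)] -/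
theorem le_ekpMu {n m r s : ℕ} (hn : n ≠ 0) (h : ∀ d : ℕ, d ∣ n → 0 < d → m ≤ ekpTerm d r s) :
    m ≤ ekpMu n r s := by
  rw [ekpMu_of_ne_zero hn]
  exact Finset.le_inf' _ _ (fun d hd => h d (Nat.dvd_of_mem_divisors hd) (Nat.pos_of_mem_divisors hd))

/-! ## Arithmetic of ceilings -/

/-- If `d ∣ x` and `a ≤ x` then `d·⌈a/d⌉ ≤ x`. [folklore] -/
private theorem mul_ceilDiv_le_of_dvd_of_le {d x a : ℕ} (hd : 0 < d) (hdx : d ∣ x) (hax : a ≤ x) :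
    d * ((a + d - 1) / d) ≤ x := by
  obtain ⟨q, rfl⟩ := hdx
  refine Nat.mul_le_mul_left d ?_
  have h1 : (a + d - 1) / d < q + 1 := by
    rw [Nat.div_lt_iff_lt_mul hd, Nat.succ_mul]
    have : d * q = q * d := Nat.mul_comm d q
    omega
  omega

/-- `a ≤ d·⌈a/d⌉`. [folklore] -/
private theorem le_mul_ceilDiv {d : ℕ} (hd : 0 < d) (a : ℕ) : a ≤ d * ((a + d - 1) / d) := by
  have h := Nat.lt_div_mul_add (a := a + d - 1) hd
  have : (a + d - 1) / d * d = d * ((a + d - 1) / d) := Nat.mul_comm _ _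
  omega

/-- `⌈a/d⌉ ≤ m` when `a ≤ m·d`. [folklore] -/
private theorem ceilDiv_le_of_le_mul {d m a : ℕ} (hd : 0 < d) (h : a ≤ m * d) : (a + d - 1) / d ≤ m := by
  have h1 : (a + d - 1) / d < m + 1 := by
    rw [Nat.div_lt_iff_lt_mul hd, Nat.succ_mul]
    omega
  omega

/-! ## The lower bound (Kneser half of the EKP theorem), any finite abelian group -/

section LowerBound

variable {G : Type*} [AddCommGroup G] [DecidableEq G]

/-- **EKP lower bound at the stabiliser.**  For finite non-empty `A, B` in an abelian group and
`d = |Stab(A + B)|`: `d⌈|A|/d⌉ + d⌈|B|/d⌉ − d ≤ |A + B|` — Kneser's theorem `|A + H| + |B + H| ≤ |A + B| + |H|`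
together with "`A + H ⊇ A` is a union of `H`-cosets". [cite: EliahouKervairePlagne2003, main Thm (lower bound, via Kneser)] -/
theorem ekpTerm_card_addStab_le_card_add {A B : Finset G} (hA : A.Nonempty) (hB : B.Nonempty) :
    ekpTerm #(A + B).addStab #A #B ≤ #(A + B) := by
  classical
  set H : Finset G := (A + B).addStab with hH
  have hABne : (A + B).Nonempty := hA.add hB
  have hHne : H.Nonempty := hABne.addStab
  have h0H : (0 : G) ∈ H := hABne.zero_mem_addStab
  have hd : 0 < #H := hHne.card_pos
  have hkn := Literature.Combinatorics.Additive.add_kneser (s := A) (t := B)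
  rw [← hH] at hkn
  have hdA : #H ∣ #(A + H) := card_addStab_dvd_card_add_addStab A (A + B)
  have hdB : #H ∣ #(B + H) := card_addStab_dvd_card_add_addStab B (A + B)
  have hAsub : #A ≤ #(A + H) := card_le_card (subset_add_left A h0H)
  have hBsub : #B ≤ #(B + H) := card_le_card (subset_add_left B h0H)
  have h1 := mul_ceilDiv_le_of_dvd_of_le hd hdA hAsub
  have h2 := mul_ceilDiv_le_of_dvd_of_le hd hdB hBsub
  rw [ekpTerm_def, mul_add]
  omega

/-- **EKP lower bound, divisor form.**  In a FINITE abelian group: for non-empty `A, B` there is a divisor `d` of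
`|G|` (the order of `Stab(A + B)`) with `(⌈|A|/d⌉ + ⌈|B|/d⌉ − 1)·d ≤ |A + B|`.
[cite: EliahouKervairePlagne2003, main Thm (lower bound, via Kneser)] -/
theorem exists_dvd_ekpTerm_le_card_add [Fintype G] {A B : Finset G} (hA : A.Nonempty) (hB : B.Nonempty) :
    ∃ d : ℕ, d ∣ Fintype.card G ∧ 0 < d ∧ ekpTerm d #A #B ≤ #(A + B) :=
  ⟨#(A + B).addStab, (hA.add hB).card_addStab_dvd_card_univ, (hA.add hB).addStab.card_pos,
    ekpTerm_card_addStab_le_card_add hA hB⟩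

/-- **EKP lower bound: `μ_G(|A|, |B|) ≤ |A + B|`** for non-empty `A, B` in a finite abelian group `G`, with
`μ_G(r,s) = min_{d ∣ |G|} (⌈r/d⌉ + ⌈s/d⌉ − 1)·d`. [cite: EliahouKervairePlagne2003, main Thm] -/
theorem ekpMu_le_card_add [Fintype G] {A B : Finset G} (hA : A.Nonempty) (hB : B.Nonempty) :
    ekpMu (Fintype.card G) #A #B ≤ #(A + B) := by
  obtain ⟨d, hd, hdpos, hle⟩ := exists_dvd_ekpTerm_le_card_add hA hB
  have hn : Fintype.card G ≠ 0 := Fintype.card_ne_zero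
  exact (ekpMu_le_ekpTerm hn hd _ _).trans hle

/-- Difference-set form of the lower bound: `μ_G(|A|, |B|) ≤ |A − B|`. [cite: EliahouKervairePlagne2003, main Thm] -/
theorem ekpMu_le_card_sub [Fintype G] {A B : Finset G} (hA : A.Nonempty) (hB : B.Nonempty) :
    ekpMu (Fintype.card G) #A #B ≤ #(A - B) := by
  have h := ekpMu_le_card_add hA hB.neg
  rwa [card_neg, ← sub_eq_add_neg] at h

/-- In particular `μ_G(|S|, |S|) = min_{d ∣ |G|} (2⌈|S|/d⌉ − 1)·d ≤ |S − S|` — the size bound used (under the name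
`knLB`) by the cell's rule E3K. [cite: EliahouKervairePlagne2003, main Thm] -/
theorem ekpMu_le_card_sub_self [Fintype G] {S : Finset G} (hS : S.Nonempty) :
    ekpMu (Fintype.card G) #S #S ≤ #(S - S) :=
  ekpMu_le_card_sub hS hS

end LowerBound

/-! ## Attainment in `ℤ/n`: coset progressions -/

section Cyclic

variable {n : ℕ}

/-- The block map `(i, j) ↦ i + m·j (mod n)`: for `n = m·d` the image of `{0,…,k−1} × {0,…,d−1}` is the union of the
`k` consecutive cosets `i + H`, `i < k`, of the subgroup `H = m·ℤ/n` of order `d`.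
[cite: EliahouKervairePlagne2003, main Thm (construction)] -/
def blockMap (n m : ℕ) (p : ℕ × ℕ) : ZMod n := ((p.1 : ℕ) : ZMod n) + (m : ZMod n) * ((p.2 : ℕ) : ZMod n)

/-- The coset progression `P_k + H = {i + m·j : i < k, j < d} ⊆ ℤ/n`. [cite: EliahouKervairePlagne2003, main Thm (construction)] -/
def cosetProg (n m d k : ℕ) : Finset (ZMod n) := ((range k) ×ˢ (range d)).image (blockMap n m)

/-- Membership in a coset progression. [cite: EliahouKervairePlagne2003, main Thm (construction)] -/
theorem mem_cosetProg {m d k : ℕ} {x : ZMod n} :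
    x ∈ cosetProg n m d k ↔ ∃ i j : ℕ, i < k ∧ j < d ∧ blockMap n m (i, j) = x := by
  simp only [cosetProg, mem_image, mem_product, mem_range, Prod.exists]
  constructor
  · rintro ⟨i, j, ⟨hi, hj⟩, h⟩; exact ⟨i, j, hi, hj, h⟩
  · rintro ⟨i, j, hi, hj, h⟩; exact ⟨i, j, ⟨hi, hj⟩, h⟩

/-- The block `(i, j)` lies in `P_k + H` for `i < k`, `j < d`. [cite: EliahouKervairePlagne2003, main Thm (construction)] -/
theorem blockMap_mem_cosetProg {m d k i j : ℕ} (hi : i < k) (hj : j < d) :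
    blockMap n m (i, j) ∈ cosetProg n m d k :=
  mem_cosetProg.2 ⟨i, j, hi, hj, rfl⟩

/-- `|P_k + H| ≤ k·d` always. [cite: EliahouKervairePlagne2003, main Thm (construction)] -/
theorem card_cosetProg_le (m d k : ℕ) : #(cosetProg n m d k) ≤ k * d := by
  unfold cosetProg
  refine card_image_le.trans ?_
  rw [card_product, card_range, card_range]

/-- In `ℤ/n` with `m·d = n`: `m·(a mod d) = m·a`. [folklore] -/
private theorem natCast_mul_natCast_mod {m d : ℕ} (hmd : m * d = n) (a : ℕ) :
    (m : ZMod n) * ((a % d : ℕ) : ZMod n) = (m : ZMod n) * (a : ZMod n) := by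
  have hz : (m : ZMod n) * (d : ZMod n) = 0 := by
    rw [← Nat.cast_mul, hmd, ZMod.natCast_self]
  conv_rhs => rw [← Nat.mod_add_div a d]
  push_cast
  rw [mul_add, ← mul_assoc, hz, zero_mul, add_zero]

/-- `|P_k + H| = k·d` when `k ≤ m` and `m·d = n` (the block map is injective on `{0,…,k−1} × {0,…,d−1}`).
[cite: EliahouKervairePlagne2003, main Thm (construction)] -/
theorem card_cosetProg {m d k : ℕ} (hmd : m * d = n) (hk : k ≤ m) : #(cosetProg n m d k) = k * d := by
  unfold cosetProg
  rw [card_image_of_injOn, card_product, card_range, card_range]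
  rintro ⟨i, j⟩ hij ⟨i', j'⟩ hij' h
  simp only [coe_product, coe_range, Set.mem_prod, Set.mem_Iio] at hij hij'
  simp only [blockMap] at h
  have hlt : ∀ {a b : ℕ}, a < k → b < d → a + m * b < n := by
    intro a b ha hb
    have : m * b + m ≤ m * d := by
      have : m * (b + 1) ≤ m * d := Nat.mul_le_mul_left m hb
      linarith
    omega
  have h1 : ((i + m * j : ℕ) : ZMod n) = ((i' + m * j' : ℕ) : ZMod n) := by push_cast; exact h
  rw [ZMod.natCast_eq_natCast_iff', Nat.mod_eq_of_lt (hlt hij.1 hij.2),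
    Nat.mod_eq_of_lt (hlt hij'.1 hij'.2)] at h1
  -- `i + m j = i' + m j'` with `i, i' < m` forces `i = i'`, `j = j'`
  have hm : 0 < m := lt_of_le_of_lt (Nat.zero_le _) (lt_of_lt_of_le hij.1 hk)
  have hi : i = i' := by
    have := congrArg (· % m) h1
    simpa [Nat.add_mul_mod_self_left, Nat.mod_eq_of_lt (lt_of_lt_of_le hij.1 hk),
      Nat.mod_eq_of_lt (lt_of_lt_of_le hij'.1 hk)] using this
  subst hi
  have hj : j = j' := by
    have h2 : m * j = m * j' := by omega
    exact Nat.eq_of_mul_eq_mul_left hm h2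
  subst hj
  rfl

/-- **Sums of coset progressions**: `(P_k + H) + (P_l + H) ⊆ P_{k+l−1} + H` in `ℤ/n`, `n = m·d`.
[cite: EliahouKervairePlagne2003, main Thm (construction)] -/
theorem cosetProg_add_cosetProg_subset {m d k l : ℕ} (hmd : m * d = n) :
    cosetProg n m d k + cosetProg n m d l ⊆ cosetProg n m d (k + l - 1) := by
  intro x hx
  rw [mem_add] at hx
  obtain ⟨y, hy, z, hz, rfl⟩ := hx
  obtain ⟨i, j, hi, hj, rfl⟩ := mem_cosetProg.1 hy
  obtain ⟨i', j', hi', hj', rfl⟩ := mem_cosetProg.1 hz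
  have hd : 0 < d := lt_of_le_of_lt (Nat.zero_le _) hj
  refine mem_cosetProg.2 ⟨i + i', (j + j') % d, by omega, Nat.mod_lt _ hd, ?_⟩
  simp only [blockMap]
  rw [natCast_mul_natCast_mod hmd]
  push_cast
  ring

/-- **Differences of coset progressions**: `(P_k + H) − (P_l + H) ⊆ −(l−1) + (P_{k+l−1} + H)` in `ℤ/n`, `n = m·d`.
[cite: EliahouKervairePlagne2003, main Thm (construction)] -/
theorem cosetProg_sub_cosetProg_subset {m d k l : ℕ} (hmd : m * d = n) :
    cosetProg n m d k - cosetProg n m d l ⊆ (-(((l - 1 : ℕ) : ZMod n))) +ᵥ cosetProg n m d (k + l - 1) := by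
  intro x hx
  rw [mem_sub] at hx
  obtain ⟨y, hy, z, hz, rfl⟩ := hx
  obtain ⟨i, j, hi, hj, rfl⟩ := mem_cosetProg.1 hy
  obtain ⟨i', j', hi', hj', rfl⟩ := mem_cosetProg.1 hz
  have hd : 0 < d := lt_of_le_of_lt (Nat.zero_le _) hj
  rw [mem_vadd_finset]
  refine ⟨blockMap n m (i + (l - 1) - i', (j + (d - j')) % d),
    blockMap_mem_cosetProg (by omega) (Nat.mod_lt _ hd), ?_⟩
  simp only [blockMap, vadd_eq_add]
  rw [natCast_mul_natCast_mod hmd]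
  have hz : (m : ZMod n) * (d : ZMod n) = 0 := by
    rw [← Nat.cast_mul, hmd, ZMod.natCast_self]
  have e1 : ((i + (l - 1) - i' : ℕ) : ZMod n) = (i : ZMod n) + ((l - 1 : ℕ) : ZMod n) - (i' : ZMod n) := by
    rw [Nat.cast_sub (by omega), Nat.cast_add]
  have e2 : ((j + (d - j') : ℕ) : ZMod n) = (j : ZMod n) + ((d : ZMod n) - (j' : ZMod n)) := by
    rw [Nat.cast_add, Nat.cast_sub hj'.le]
  rw [e1, e2]
  linear_combination hz

/-- Hence `|(P_k + H) − (P_l + H)| ≤ (k + l − 1)·d`. [cite: EliahouKervairePlagne2003, main Thm (construction)] -/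
theorem card_cosetProg_sub_cosetProg_le {m d k l : ℕ} (hmd : m * d = n) :
    #(cosetProg n m d k - cosetProg n m d l) ≤ (k + l - 1) * d :=
  (card_le_card (cosetProg_sub_cosetProg_subset hmd)).trans
    (by rw [card_vadd_finset]; exact card_cosetProg_le _ _ _)

/-- **EKP upper bound in `ℤ/n` (the construction).**  For `d ∣ n`, `1 ≤ r ≤ n` and `s ≤ n` there are `A, B ⊆ ℤ/n` with
`|A| = r`, `|B| = s` and `|A + B| ≤ (⌈r/d⌉ + ⌈s/d⌉ − 1)·d`: take `A` inside `⌈r/d⌉` consecutive cosets of the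
subgroup of order `d` (all but the last one full) and `B` likewise. [cite: EliahouKervairePlagne2003, main Thm] -/
theorem exists_card_add_le_ekpTerm_zmod {d r s : ℕ} (hdn : d ∣ n) (hr : 1 ≤ r) (hrn : r ≤ n)
    (hsn : s ≤ n) : ∃ A B : Finset (ZMod n), #A = r ∧ #B = s ∧ #(A + B) ≤ ekpTerm d r s := by
  obtain ⟨m, hnm⟩ := hdn
  have hn : 0 < n := by omega
  have hd : 0 < d := Nat.pos_of_ne_zero (by rintro rfl; simp at hnm; omega)
  have hmd : m * d = n := by rw [hnm, mul_comm]
  set k := (r + d - 1) / d with hk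
  set l := (s + d - 1) / d with hl
  have hkm : k ≤ m := ceilDiv_le_of_le_mul hd (by rw [hmd]; exact hrn)
  have hlm : l ≤ m := ceilDiv_le_of_le_mul hd (by rw [hmd]; exact hsn)
  have hrk : r ≤ #(cosetProg n m d k) := by
    rw [card_cosetProg hmd hkm, mul_comm]; exact le_mul_ceilDiv hd r
  have hsl : s ≤ #(cosetProg n m d l) := by
    rw [card_cosetProg hmd hlm, mul_comm]; exact le_mul_ceilDiv hd s
  obtain ⟨A, hA, hAcard⟩ := exists_subset_card_eq hrk
  obtain ⟨B, hB, hBcard⟩ := exists_subset_card_eq hsl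
  refine ⟨A, B, hAcard, hBcard, ?_⟩
  calc #(A + B) ≤ #(cosetProg n m d k + cosetProg n m d l) := card_le_card (add_subset_add hA hB)
    _ ≤ #(cosetProg n m d (k + l - 1)) := card_le_card (cosetProg_add_cosetProg_subset hmd)
    _ ≤ (k + l - 1) * d := card_cosetProg_le _ _ _
    _ = ekpTerm d r s := by rw [ekpTerm_eq_sub_one_mul]

/-- **EKP theorem for cyclic groups: `μ_{ℤ/n}(r, s) = min_{d ∣ n} (⌈r/d⌉ + ⌈s/d⌉ − 1)·d`.**  For `1 ≤ r, s ≤ n`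
there are `A, B ⊆ ℤ/n` with `|A| = r`, `|B| = s`, `|A + B| = ekpMu n r s`; together with `ekpMu_le_card_add`
(`ekpMu n |A| |B| ≤ |A + B|` for all non-empty `A, B ⊆ ℤ/n`) this says the minimum of `|A + B|` is exactly `ekpMu n r s`.
[cite: EliahouKervairePlagne2003, main Thm] -/
theorem exists_card_add_eq_ekpMu_zmod {r s : ℕ} (hr : 1 ≤ r) (hrn : r ≤ n) (hs : 1 ≤ s) (hsn : s ≤ n) :
    ∃ A B : Finset (ZMod n), #A = r ∧ #B = s ∧ #(A + B) = ekpMu n r s := by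
  have hn : n ≠ 0 := by omega
  haveI : NeZero n := ⟨hn⟩
  obtain ⟨d, hd, hdpos, hmu⟩ := exists_dvd_ekpMu_eq hn r s
  obtain ⟨A, B, hA, hB, hle⟩ := exists_card_add_le_ekpTerm_zmod hd hr hrn hsn
  refine ⟨A, B, hA, hB, le_antisymm (hmu ▸ hle) ?_⟩
  have hAne : A.Nonempty := card_pos.1 (by omega)
  have hBne : B.Nonempty := card_pos.1 (by omega)
  have h := ekpMu_le_card_add hAne hBne
  rwa [ZMod.card, hA, hB] at h

/-- The `μ`-bound in `ℤ/n` with the group order made explicit: `ekpMu n |A| |B| ≤ |A + B|`.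
[cite: EliahouKervairePlagne2003, main Thm] -/
theorem ekpMu_le_card_add_zmod [NeZero n] {A B : Finset (ZMod n)} (hA : A.Nonempty) (hB : B.Nonempty) :
    ekpMu n #A #B ≤ #(A + B) := by
  have h := ekpMu_le_card_add hA hB
  rwa [ZMod.card] at h

/-- **One set and its difference set.**  For `d ∣ n` and `1 ≤ r ≤ n` there is `S ⊆ ℤ/n` with `|S| = r` and
`|S − S| ≤ (2⌈r/d⌉ − 1)·d` (the same coset progression). [cite: EliahouKervairePlagne2003, main Thm] -/
theorem exists_card_sub_self_le_zmod {d r : ℕ} (hdn : d ∣ n) (hr : 1 ≤ r) (hrn : r ≤ n) :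
    ∃ S : Finset (ZMod n), #S = r ∧ #(S - S) ≤ ekpTerm d r r := by
  obtain ⟨m, hnm⟩ := hdn
  have hn : 0 < n := by omega
  have hd : 0 < d := Nat.pos_of_ne_zero (by rintro rfl; simp at hnm; omega)
  have hmd : m * d = n := by rw [hnm, mul_comm]
  set k := (r + d - 1) / d with hk
  have hkm : k ≤ m := ceilDiv_le_of_le_mul hd (by rw [hmd]; exact hrn)
  have hrk : r ≤ #(cosetProg n m d k) := by
    rw [card_cosetProg hmd hkm, mul_comm]; exact le_mul_ceilDiv hd r
  obtain ⟨S, hS, hScard⟩ := exists_subset_card_eq hrk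
  refine ⟨S, hScard, ?_⟩
  calc #(S - S) ≤ #(cosetProg n m d k - cosetProg n m d k) := card_le_card (sub_subset_sub hS hS)
    _ ≤ (k + k - 1) * d := card_cosetProg_sub_cosetProg_le hmd
    _ = ekpTerm d r r := by rw [ekpTerm_eq_sub_one_mul]

/-- **The exact minimum of `|S − S|` over `r`-subsets of `ℤ/n` is `μ(n; r, r) = min_{d ∣ n} (2⌈r/d⌉ − 1)·d`**
(lower bound for every `S` by `ekpMu_le_card_sub_self`, attained here) — the census function `knLB n r` of the
cell's rule E3K is therefore best possible as a function of `(n, r)` alone.  This is `ρ⁻_{ℤ/n}(r)` of Lee 2018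
(Thm "cyclic", cf. Bajnok–Matzke 2015); in NON-cyclic groups `ρ⁻` can exceed `μ` (Lee, Remark 2).
[cite: Lee2018, Thm (cyclic)] [cite: EliahouKervairePlagne2003, main Thm] -/
theorem exists_card_sub_self_eq_ekpMu_zmod {r : ℕ} (hr : 1 ≤ r) (hrn : r ≤ n) :
    ∃ S : Finset (ZMod n), #S = r ∧ #(S - S) = ekpMu n r r := by
  have hn : n ≠ 0 := by omega
  haveI : NeZero n := ⟨hn⟩
  obtain ⟨d, hd, hdpos, hmu⟩ := exists_dvd_ekpMu_eq hn r r
  obtain ⟨S, hS, hle⟩ := exists_card_sub_self_le_zmod hd hr hrn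
  refine ⟨S, hS, le_antisymm (hmu ▸ hle) ?_⟩
  have hSne : S.Nonempty := card_pos.1 (by omega)
  have h := ekpMu_le_card_sub_self hSne
  rwa [ZMod.card, hS] at h

end Cyclic

/-! ## The small sumsets property of finite abelian groups and the EKP upper bound in general
(appended 2026-08-27, gen 9: discharges the `TODO(general form)` above) -/

section General

/-! ### Fibres of a surjective homomorphism -/

/-- The fibre of a map over `c`, as a finset of a fintype. [folklore] -/
private def fib {G : Type*} [Fintype G] {C : Type*} [DecidableEq C] (ψ : G → C) (c : C) : Finset G :=
  univ.filter fun x => ψ x = c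

/-- Membership in a fibre. [folklore] -/
private theorem mem_fib {G : Type*} [Fintype G] {C : Type*} [DecidableEq C] {ψ : G → C} {c : C}
    {x : G} : x ∈ fib ψ c ↔ ψ x = c := by
  simp [fib]

variable {G : Type*} [AddCommGroup G] [DecidableEq G]

omit [DecidableEq G] in
/-- All fibres of a surjective additive homomorphism have the cardinality of the kernel fibre
(translate by a preimage). [folklore] -/
private theorem card_fib_eq [Fintype G] {C : Type*} [AddCommGroup C] [DecidableEq C] (ψ : G →+ C)
    (hψ : Function.Surjective ψ) (c : C) : #(fib ψ c) = #(fib ψ 0) := by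
  obtain ⟨g, hg⟩ := hψ c
  refine card_bij (fun x _ => x - g) ?_ ?_ ?_
  · intro x hx
    rw [mem_fib] at hx ⊢
    rw [map_sub, hx, hg, sub_self]
  · intro x _ y _ h
    exact sub_left_injective h
  · intro y hy
    rw [mem_fib] at hy
    refine ⟨y + g, ?_, by simp⟩
    rw [mem_fib, map_add, hy, hg, zero_add]

/-- The preimage of a finset `S` under a surjective homomorphism is the disjoint union of the fibres over
`S`, of cardinality `|S|·|ker|`. [folklore] -/
private theorem card_filter_mem_eq [Fintype G] {C : Type*} [AddCommGroup C] [DecidableEq C]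
    (ψ : G →+ C) (hψ : Function.Surjective ψ) (S : Finset C) :
    #(univ.filter fun x => ψ x ∈ S) = #S * #(fib ψ 0) := by
  have hunion : (univ.filter fun x => ψ x ∈ S) = S.biUnion (fib ψ) := by
    ext x; simp [fib]
  rw [hunion, card_biUnion, Finset.sum_congr rfl (fun c _ => card_fib_eq ψ hψ c), sum_const,
    smul_eq_mul]
  intro c _ d _ hcd
  rw [Function.onFun, disjoint_left]
  intro x hxc hxd
  rw [mem_fib] at hxc hxd
  exact hcd (hxc.symm.trans hxd)

omit [DecidableEq G] in
/-- The kernel fibre has the cardinality of the kernel. [folklore] -/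
private theorem card_fib_zero_eq [Fintype G] {C : Type*} [AddCommGroup C] [DecidableEq C]
    (ψ : G →+ C) : #(fib ψ 0) = Nat.card ψ.ker := by
  have e : ψ.ker ≃ {x : G // ψ x = 0} :=
    Equiv.subtypeEquivRight (fun x => AddMonoidHom.mem_ker)
  rw [Nat.card_congr e, Nat.card_eq_fintype_card, Fintype.card_subtype]
  rfl

/-! ### The lift: small sumsets from the kernel to the group (one coset progression + a partial coset) -/

/-- **Lifting small sumsets along a surjection onto a cyclic group.**  Let `ψ : G → ℤ/m` be a surjective
homomorphism of finite abelian groups whose kernel `K` has the small sumsets property for the sizes `ρ, σ`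
(sets `P, Q ⊆ K`, `|P| = ρ`, `|Q| = σ`, `|P + Q| ≤ ρ + σ − 1`).  Then for `r = (k−1)|K| + ρ`, `s = (l−1)|K| + σ`
with `k, l ≤ m` there are `A, B ⊆ G` with `|A| = r`, `|B| = s`, `|A + B| ≤ r + s − 1`: `A` = the full fibres over
`0, …, k−2` plus a translate of `P` inside the fibre over `k−1`, `B` likewise (the inductive step of the
Eliahou–Kervaire–Plagne construction). [cite: EliahouKervairePlagne2003, main Thm (construction)] -/
theorem exists_card_add_le_of_ker [Fintype G] {m : ℕ} [NeZero m] (ψ : G →+ ZMod m)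
    (hψ : Function.Surjective ψ) {k l ρ σ : ℕ} (hk : 1 ≤ k) (hkm : k ≤ m) (hl : 1 ≤ l) (hlm : l ≤ m)
    (hρ : 1 ≤ ρ) (hσ : 1 ≤ σ) (P Q : Finset ψ.ker) (hP : #P = ρ) (hQ : #Q = σ) (hPQ : #(P + Q) ≤ ρ + σ - 1) :
    ∃ A B : Finset G, #A = (k - 1) * Nat.card ψ.ker + ρ ∧ #B = (l - 1) * Nat.card ψ.ker + σ ∧
      #(A + B) ≤ (k - 1) * Nat.card ψ.ker + ρ + ((l - 1) * Nat.card ψ.ker + σ) - 1 := by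
  classical
  -- a section of `ψ`
  obtain ⟨g, hg⟩ : ∃ g : ZMod m → G, ∀ c, ψ (g c) = c := ⟨Function.surjInv hψ, Function.surjInv_eq hψ⟩
  set κ := Nat.card ψ.ker with hκ
  have hfib0 : #(fib ψ 0) = κ := card_fib_zero_eq ψ
  -- casting `ℕ → ZMod m` is injective below `m`
  have cast_inj : ∀ {i j : ℕ}, i < m → j < m → ((i : ZMod m) = (j : ZMod m) ↔ i = j) := by
    intro i j hi hj
    rw [ZMod.natCast_eq_natCast_iff', Nat.mod_eq_of_lt hi, Nat.mod_eq_of_lt hj]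
  -- the pieces
  let I : ℕ → Finset (ZMod m) := fun n => (range n).image (Nat.cast : ℕ → ZMod m)
  have cardI : ∀ {n : ℕ}, n ≤ m → #(I n) = n := by
    intro n hn
    rw [card_image_of_injOn, card_range]
    intro i hi j hj h
    rw [coe_range, Set.mem_Iio] at hi hj
    exact (cast_inj (lt_of_lt_of_le hi hn) (lt_of_lt_of_le hj hn)).1 h
  have memI : ∀ {n : ℕ} {c : ZMod m}, c ∈ I n ↔ ∃ i, i < n ∧ (i : ZMod m) = c := by
    intro n c; simp [I]
  let full : ℕ → Finset G := fun n => univ.filter fun x => ψ x ∈ I n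
  have card_full : ∀ {n : ℕ}, n ≤ m → #(full n) = n * κ := by
    intro n hn
    show #(univ.filter fun x => ψ x ∈ I n) = n * κ
    rw [card_filter_mem_eq ψ hψ (I n), cardI hn, hfib0]
  let emb : ψ.ker ↪ G := ⟨Subtype.val, Subtype.val_injective⟩
  let part : ℕ → Finset ψ.ker → Finset G := fun n R => (R.map emb).image fun x => g (n : ZMod m) + x
  have card_part : ∀ (n : ℕ) (R : Finset ψ.ker), #(part n R) = #R := by
    intro n R
    show #((R.map emb).image fun x => g (n : ZMod m) + x) = #R
    rw [card_image_of_injective _ (add_right_injective _), card_map]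
  have mem_part : ∀ {n : ℕ} {R : Finset ψ.ker} {x : G},
      x ∈ part n R ↔ ∃ p ∈ R, x = g (n : ZMod m) + (p : G) := by
    intro n R x
    simp only [part, mem_image, mem_map, emb, Function.Embedding.coeFn_mk]
    constructor
    · rintro ⟨y, ⟨p, hp, rfl⟩, rfl⟩; exact ⟨p, hp, rfl⟩
    · rintro ⟨p, hp, rfl⟩; exact ⟨p, ⟨p, hp, rfl⟩, rfl⟩
  have ψ_part : ∀ {n : ℕ} {R : Finset ψ.ker} {x : G}, x ∈ part n R → ψ x = (n : ZMod m) := by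
    intro n R x hx
    obtain ⟨p, _, rfl⟩ := mem_part.1 hx
    rw [map_add, hg, (AddMonoidHom.mem_ker).1 p.2, add_zero]
  have ψ_full : ∀ {n : ℕ} {x : G}, x ∈ full n → ∃ i, i < n ∧ ψ x = (i : ZMod m) := by
    intro n x hx
    have hx' : ψ x ∈ I n := (mem_filter.1 hx).2
    obtain ⟨i, hi, h⟩ := memI.1 hx'
    exact ⟨i, hi, h.symm⟩
  -- disjointness of the full part and the partial coset
  have disj : ∀ {n : ℕ} (R : Finset ψ.ker), n + 1 ≤ m → Disjoint (full n) (part n R) := by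
    intro n R hn
    rw [disjoint_left]
    intro x hxf hxp
    obtain ⟨i, hi, hψx⟩ := ψ_full hxf
    have h2 := ψ_part hxp
    rw [hψx] at h2
    have := (cast_inj (by omega) (by omega)).1 h2
    omega
  -- the sets
  refine ⟨full (k - 1) ∪ part (k - 1) P, full (l - 1) ∪ part (l - 1) Q, ?_, ?_, ?_⟩
  · rw [card_union_of_disjoint (disj P (by omega)), card_full (by omega), card_part, hP]
  · rw [card_union_of_disjoint (disj Q (by omega)), card_full (by omega), card_part, hQ]
  -- the sumset: full fibres over `0..k+l-3` plus a translate of `P + Q`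
  let T : Finset G := ((P + Q).map emb).image fun x => (g ((k - 1 : ℕ) : ZMod m) + g ((l - 1 : ℕ) : ZMod m)) + x
  have cardT : #T ≤ ρ + σ - 1 := by
    refine card_image_le.trans ?_
    rw [card_map]; exact hPQ
  have card_fullkl : #(full (k + l - 2)) ≤ (k + l - 2) * κ := by
    show #(univ.filter fun x => ψ x ∈ I (k + l - 2)) ≤ (k + l - 2) * κ
    rw [card_filter_mem_eq ψ hψ (I (k + l - 2)), hfib0]
    exact Nat.mul_le_mul_right _ (card_image_le.trans (card_range _).le)
  have hsub : full (k - 1) ∪ part (k - 1) P + (full (l - 1) ∪ part (l - 1) Q) ⊆ full (k + l - 2) ∪ T := by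
    intro z hz
    rw [mem_add] at hz
    obtain ⟨x, hx, y, hy, rfl⟩ := hz
    rw [mem_union] at hx hy ⊢
    -- helper: membership in `full n` from a small natural index
    have to_full : ∀ {i j : ℕ}, i + j < k + l - 2 → ψ x = (i : ZMod m) → ψ y = (j : ZMod m) →
        x + y ∈ full (k + l - 2) := by
      intro i j hij hxi hyj
      refine mem_filter.2 ⟨mem_univ _, memI.2 ⟨i + j, hij, ?_⟩⟩
      rw [map_add, hxi, hyj, Nat.cast_add]
    rcases hx with hx | hx <;> rcases hy with hy | hy
    · obtain ⟨i, hi, hxi⟩ := ψ_full hx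
      obtain ⟨j, hj, hyj⟩ := ψ_full hy
      exact Or.inl (to_full (by omega) hxi hyj)
    · obtain ⟨i, hi, hxi⟩ := ψ_full hx
      exact Or.inl (to_full (by omega) hxi (ψ_part hy))
    · obtain ⟨j, hj, hyj⟩ := ψ_full hy
      exact Or.inl (to_full (by omega) (ψ_part hx) hyj)
    · right
      obtain ⟨p, hp, rfl⟩ := mem_part.1 hx
      obtain ⟨q, hq, rfl⟩ := mem_part.1 hy
      simp only [T, mem_image, mem_map, emb, Function.Embedding.coeFn_mk]
      refine ⟨(p : G) + (q : G), ⟨p + q, add_mem_add hp hq, rfl⟩, ?_⟩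
      abel
  calc #(full (k - 1) ∪ part (k - 1) P + (full (l - 1) ∪ part (l - 1) Q))
      ≤ #(full (k + l - 2) ∪ T) := card_le_card hsub
    _ ≤ #(full (k + l - 2)) + #T := card_union_le _ _
    _ ≤ (k + l - 2) * κ + (ρ + σ - 1) := add_le_add card_fullkl cardT
    _ = (k - 1) * κ + ρ + ((l - 1) * κ + σ) - 1 := by
        have : (k + l - 2) * κ = (k - 1) * κ + (l - 1) * κ := by
          rw [← add_mul]; congr 1; omega
        rw [this]; omega

/-! ### Every finite abelian group maps onto a non-trivial cyclic group -/

omit [DecidableEq G] in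
/-- A non-trivial finite abelian group has a surjective homomorphism onto `ℤ/m` for some `m ≥ 2` (project the
invariant-factor decomposition `G ≅ ∏ ℤ/m_j` onto one factor). [folklore] -/
private theorem exists_surjective_zmod [Fintype G] (hG : 1 < Fintype.card G) :
    ∃ (m : ℕ) (ψ : G →+ ZMod m), 1 < m ∧ Function.Surjective ψ := by
  obtain ⟨t, m, hm, -, ⟨e⟩⟩ := Literature.GroupTheory.FiniteAbelian.exists_addEquiv_pi_zmod_chain_of_finite G
  rcases Nat.eq_zero_or_pos t with rfl | ht
  · exfalso
    have h1 : Fintype.card G = 1 := by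
      rw [Fintype.card_congr e.toEquiv]
      exact Fintype.card_eq_one_iff.2 ⟨fun j => Fin.elim0 j, fun f => funext fun j => Fin.elim0 j⟩
    omega
  refine ⟨m ⟨0, ht⟩, (Pi.evalAddMonoidHom (fun j => ZMod (m j)) ⟨0, ht⟩).comp e.toAddMonoidHom,
    hm _, ?_⟩
  intro c
  refine ⟨e.symm (Pi.single (⟨0, ht⟩ : Fin t) c), ?_⟩
  simp

/-! ### The small sumsets property -/

/-- **Every finite abelian group has the small sumsets property** (Eliahou–Kervaire–Plagne; the `d = 1` term of
`μ_G`): for `1 ≤ r, s ≤ |G|` there are `A, B ⊆ G` with `|A| = r`, `|B| = s`, `|A + B| ≤ r + s − 1`.  Proof by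
induction on `|G|` along a surjection onto a cyclic group (`exists_card_add_le_of_ker`).
[cite: EliahouKervairePlagne2003, main Thm] [cite: Plagne2007, p. 379 eq. (2)] -/
theorem exists_card_add_le_add_sub_one :
    ∀ (n : ℕ) (G : Type*) [AddCommGroup G] [Fintype G] [DecidableEq G], Fintype.card G = n →
      ∀ r s : ℕ, 1 ≤ r → r ≤ n → 1 ≤ s → s ≤ n →
        ∃ A B : Finset G, #A = r ∧ #B = s ∧ #(A + B) ≤ r + s - 1 := by
  intro n
  induction n using Nat.strong_induction_on with
  | _ n ih =>
  intro G _ _ _ hn r s hr hrn hs hsn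
  classical
  by_cases h1 : n = 1
  · -- trivial group: `r = s = 1`
    subst h1
    refine ⟨{0}, {0}, ?_, ?_, ?_⟩
    · rw [card_singleton]; omega
    · rw [card_singleton]; omega
    · rw [singleton_add_singleton, add_zero, card_singleton]; omega
  have hn1 : 1 < n := by
    have : 0 < Fintype.card G := Fintype.card_pos
    omega
  obtain ⟨m, ψ, hm, hψ⟩ := exists_surjective_zmod (G := G) (hn ▸ hn1)
  haveI : NeZero m := ⟨by omega⟩
  -- the kernel and its order (`κ = |ker ψ|`, `|G| = m κ`)
  have hGκ : Fintype.card G = m * Nat.card ψ.ker := by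
    have h := card_filter_mem_eq ψ hψ (univ : Finset (ZMod m))
    rw [card_fib_zero_eq, Finset.card_univ, ZMod.card] at h
    rw [← h, ← Finset.card_univ]
    congr 1; ext x; simp
  have hκpos : 0 < Nat.card ψ.ker := by
    rw [Nat.card_pos_iff]; exact ⟨⟨⟨0, (AddMonoidHom.mem_ker).2 (map_zero ψ)⟩⟩, inferInstance⟩
  have hκn : Nat.card ψ.ker < n := by
    rw [← hn, hGκ]
    have : 1 * Nat.card ψ.ker < m * Nat.card ψ.ker := Nat.mul_lt_mul_of_pos_right hm hκpos
    omega
  -- sizes: `r = (k-1)κ + ρ`, `s = (l-1)κ + σ` with `k = ⌈r/κ⌉`, `l = ⌈s/κ⌉`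
  obtain ⟨κ, hκ⟩ : ∃ κ, Nat.card ψ.ker = κ := ⟨_, rfl⟩
  rw [hκ] at hGκ hκpos hκn
  obtain ⟨k, hk⟩ : ∃ k, (r + κ - 1) / κ = k := ⟨_, rfl⟩
  obtain ⟨l, hl⟩ : ∃ l, (s + κ - 1) / κ = l := ⟨_, rfl⟩
  have hrk : r ≤ k * κ := by
    have h1 := le_mul_ceilDiv hκpos r
    rw [hk, Nat.mul_comm] at h1; exact h1
  have hkr : k * κ ≤ r + κ - 1 := by
    have h2 := Nat.div_mul_le_self (r + κ - 1) κ
    rw [hk] at h2; exact h2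
  have hsl : s ≤ l * κ := by
    have h1 := le_mul_ceilDiv hκpos s
    rw [hl, Nat.mul_comm] at h1; exact h1
  have hls : l * κ ≤ s + κ - 1 := by
    have h2 := Nat.div_mul_le_self (s + κ - 1) κ
    rw [hl] at h2; exact h2
  have hk1 : 1 ≤ k := by rw [← hk, Nat.one_le_div_iff hκpos]; omega
  have hl1 : 1 ≤ l := by rw [← hl, Nat.one_le_div_iff hκpos]; omega
  have hkm : k ≤ m := by
    rw [← hk]; exact ceilDiv_le_of_le_mul hκpos (by rw [← hGκ, hn]; exact hrn)
  have hlm : l ≤ m := by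
    rw [← hl]; exact ceilDiv_le_of_le_mul hκpos (by rw [← hGκ, hn]; exact hsn)
  have hkκ : (k - 1) * κ = k * κ - κ := Nat.sub_one_mul k κ
  have hlκ : (l - 1) * κ = l * κ - κ := Nat.sub_one_mul l κ
  have hkκ' : κ ≤ k * κ := Nat.le_mul_of_pos_left κ hk1
  have hlκ' : κ ≤ l * κ := Nat.le_mul_of_pos_left κ hl1
  obtain ⟨ρ, hρ⟩ : ∃ ρ, r - (k - 1) * κ = ρ := ⟨_, rfl⟩
  obtain ⟨σ, hσ⟩ : ∃ σ, s - (l - 1) * κ = σ := ⟨_, rfl⟩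
  have hρ1 : 1 ≤ ρ := by omega
  have hσ1 : 1 ≤ σ := by omega
  have hρκ : ρ ≤ κ := by omega
  have hσκ : σ ≤ κ := by omega
  have hrρ : (k - 1) * κ + ρ = r := by omega
  have hsσ : (l - 1) * κ + σ = s := by omega
  -- the kernel has the property by induction
  haveI : Fintype ψ.ker := Fintype.ofFinite _
  have hcardK : Fintype.card ψ.ker = κ := by rw [← hκ, Nat.card_eq_fintype_card]
  obtain ⟨P, Q, hP, hQ, hPQ⟩ := ih κ hκn ψ.ker hcardK ρ σ hρ1 hρκ hσ1 hσκ
  obtain ⟨A, B, hA, hB, hAB⟩ :=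
    exists_card_add_le_of_ker ψ hψ hk1 hkm hl1 hlm hρ1 hσ1 P Q hP hQ hPQ
  rw [hκ, hrρ] at hA
  rw [hκ, hsσ] at hB
  rw [hκ, hrρ, hsσ] at hAB
  exact ⟨A, B, hA, hB, hAB⟩

/-- **Small sumsets property**, instance form: for `1 ≤ r, s ≤ |G|` in a finite abelian group `G` there are
`A, B` with `|A| = r`, `|B| = s`, `|A + B| ≤ r + s − 1` — i.e. `μ_G(r, s) ≤ r + s − 1`.
[cite: EliahouKervairePlagne2003, main Thm] -/
theorem exists_card_add_le_add_sub_one' [Fintype G] {r s : ℕ} (hr : 1 ≤ r) (hrG : r ≤ Fintype.card G)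
    (hs : 1 ≤ s) (hsG : s ≤ Fintype.card G) :
    ∃ A B : Finset G, #A = r ∧ #B = s ∧ #(A + B) ≤ r + s - 1 :=
  exists_card_add_le_add_sub_one _ G rfl r s hr hrG hs hsG

/-! ### The EKP upper bound for every divisor, every finite abelian group -/

/-- **EKP upper bound (the construction), every finite abelian group.**  For `d ∣ |G|` and `1 ≤ r, s ≤ |G|`
there are `A, B ⊆ G` with `|A| = r`, `|B| = s`, `|A + B| ≤ (⌈r/d⌉ + ⌈s/d⌉ − 1)·d`: take a subgroup `H` of order
`d` (converse of Lagrange for abelian groups), sets `A′, B′` of `⌈r/d⌉`, `⌈s/d⌉` cosets with `|A′ + B′| ≤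
⌈r/d⌉ + ⌈s/d⌉ − 1` in `G/H` (small sumsets property), and `r` resp. `s` elements of their preimages.
[cite: EliahouKervairePlagne2003, main Thm (construction)] -/
theorem exists_card_add_le_ekpTerm [Fintype G] {d r s : ℕ} (hd : d ∣ Fintype.card G) (hr : 1 ≤ r)
    (hrG : r ≤ Fintype.card G) (hs : 1 ≤ s) (hsG : s ≤ Fintype.card G) :
    ∃ A B : Finset G, #A = r ∧ #B = s ∧ #(A + B) ≤ ekpTerm d r s := by
  classical
  -- a subgroup of order `d` and the quotient map
  have hd' : d ∣ Nat.card G := by rwa [Nat.card_eq_fintype_card]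
  obtain ⟨H, hH⟩ := Literature.GroupTheory.FiniteAbelian.exists_addSubgroup_card_eq_of_dvd_card G hd'
  have hdpos : 0 < d := Nat.pos_of_dvd_of_pos hd Fintype.card_pos
  let π : G →+ G ⧸ H := QuotientAddGroup.mk' H
  have hπ : Function.Surjective π := QuotientAddGroup.mk'_surjective H
  haveI : Fintype (G ⧸ H) := Fintype.ofFinite _
  -- fibres of `π` have `d` elements
  have hker : Nat.card π.ker = d := by
    rw [show π.ker = H from QuotientAddGroup.ker_mk' H, hH]
  have hfib : #(fib π 0) = d := by rw [card_fib_zero_eq, hker]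
  -- `|G/H| = |G| / d`
  have hQ : Fintype.card G = Fintype.card (G ⧸ H) * d := by
    have h := card_filter_mem_eq π hπ (univ : Finset (G ⧸ H))
    rw [hfib, card_univ] at h
    rw [← h]
    simp
  -- the quotient sets
  set k := (r + d - 1) / d with hk
  set l := (s + d - 1) / d with hl
  have hk1 : 1 ≤ k := by rw [hk, Nat.one_le_div_iff hdpos]; omega
  have hl1 : 1 ≤ l := by rw [hl, Nat.one_le_div_iff hdpos]; omega
  have hkQ : k ≤ Fintype.card (G ⧸ H) := ceilDiv_le_of_le_mul hdpos (by rw [← hQ]; exact hrG)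
  have hlQ : l ≤ Fintype.card (G ⧸ H) := ceilDiv_le_of_le_mul hdpos (by rw [← hQ]; exact hsG)
  obtain ⟨A', B', hA', hB', hA'B'⟩ := exists_card_add_le_add_sub_one' (G := G ⧸ H) hk1 hkQ hl1 hlQ
  -- preimages
  have hrA : r ≤ #(univ.filter fun x => π x ∈ A') := by
    rw [card_filter_mem_eq π hπ A', hfib, hA', Nat.mul_comm]
    exact le_mul_ceilDiv hdpos r
  have hsB : s ≤ #(univ.filter fun x => π x ∈ B') := by
    rw [card_filter_mem_eq π hπ B', hfib, hB', Nat.mul_comm]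
    exact le_mul_ceilDiv hdpos s
  obtain ⟨A, hA, hAcard⟩ := exists_subset_card_eq hrA
  obtain ⟨B, hB, hBcard⟩ := exists_subset_card_eq hsB
  refine ⟨A, B, hAcard, hBcard, ?_⟩
  have hsub : A + B ⊆ univ.filter fun x => π x ∈ A' + B' := by
    intro z hz
    rw [mem_add] at hz
    obtain ⟨x, hx, y, hy, rfl⟩ := hz
    have hx' := (mem_filter.1 (hA hx)).2
    have hy' := (mem_filter.1 (hB hy)).2
    exact mem_filter.2 ⟨mem_univ _, by rw [map_add]; exact add_mem_add hx' hy'⟩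
  calc #(A + B) ≤ #(univ.filter fun x => π x ∈ A' + B') := card_le_card hsub
    _ = #(A' + B') * d := by rw [card_filter_mem_eq π hπ (A' + B'), hfib]
    _ ≤ (k + l - 1) * d := Nat.mul_le_mul_right _ hA'B'
    _ = ekpTerm d r s := by rw [ekpTerm_eq_sub_one_mul]

/-- **Eliahou–Kervaire–Plagne 2003, the full theorem: `μ_G(r, s) = min_{d ∣ |G|} (⌈r/d⌉ + ⌈s/d⌉ − 1)·d` in EVERY
finite abelian group.**  For `1 ≤ r, s ≤ |G|` there are `A, B ⊆ G` with `|A| = r`, `|B| = s` and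
`|A + B| = ekpMu |G| r s`; with `ekpMu_le_card_add` (every pair of non-empty sets satisfies
`ekpMu |G| |A| |B| ≤ |A + B|`) this is the printed equality. [cite: EliahouKervairePlagne2003, main Thm]
[cite: Plagne2007, p. 379 eq. (2)] -/
theorem exists_card_add_eq_ekpMu [Fintype G] {r s : ℕ} (hr : 1 ≤ r) (hrG : r ≤ Fintype.card G) (hs : 1 ≤ s)
    (hsG : s ≤ Fintype.card G) :
    ∃ A B : Finset G, #A = r ∧ #B = s ∧ #(A + B) = ekpMu (Fintype.card G) r s := by
  have hn : Fintype.card G ≠ 0 := Fintype.card_ne_zero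
  obtain ⟨d, hd, hdpos, hmu⟩ := exists_dvd_ekpMu_eq hn r s
  obtain ⟨A, B, hA, hB, hle⟩ := exists_card_add_le_ekpTerm hd hr hrG hs hsG
  refine ⟨A, B, hA, hB, le_antisymm (hmu ▸ hle) ?_⟩
  have hAne : A.Nonempty := card_pos.1 (by omega)
  have hBne : B.Nonempty := card_pos.1 (by omega)
  have h := ekpMu_le_card_add hAne hBne
  rwa [hA, hB] at h

end General

/-! ## One set: `ρ⁺_G(r) = min |A + A| = μ_G(r, r)` (Eliahou–Kervaire; Lee 2018 Thm 1) — appended gen 9 -/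

section Diagonal

variable {G : Type*} [AddCommGroup G] [DecidableEq G]

/-- The lift of `exists_card_add_le_of_ker` as a CONSTRUCTION `F n R` (full fibres over `0..n−1` plus a translate of
`R ⊆ ker ψ` in the fibre over `n`), so that equal data give equal sets (needed for `A + A`). [folklore] -/
private theorem exists_liftSet [Fintype G] {m : ℕ} [NeZero m] (ψ : G →+ ZMod m)
    (hψ : Function.Surjective ψ) :
    ∃ F : ℕ → Finset ψ.ker → Finset G,
      (∀ (n : ℕ) (R : Finset ψ.ker), n + 1 ≤ m → #(F n R) = n * Nat.card ψ.ker + #R) ∧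
      (∀ (k l : ℕ) (P Q : Finset ψ.ker), 1 ≤ k → k ≤ m → 1 ≤ l → l ≤ m →
        #(F (k - 1) P + F (l - 1) Q) ≤ (k + l - 2) * Nat.card ψ.ker + #(P + Q)) := by
  classical
  obtain ⟨g, hg⟩ : ∃ g : ZMod m → G, ∀ c, ψ (g c) = c := ⟨Function.surjInv hψ, Function.surjInv_eq hψ⟩
  set κ := Nat.card ψ.ker with hκ
  have hfib0 : #(fib ψ 0) = κ := card_fib_zero_eq ψ
  have cast_inj : ∀ {i j : ℕ}, i < m → j < m → ((i : ZMod m) = (j : ZMod m) ↔ i = j) := by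
    intro i j hi hj
    rw [ZMod.natCast_eq_natCast_iff', Nat.mod_eq_of_lt hi, Nat.mod_eq_of_lt hj]
  let I : ℕ → Finset (ZMod m) := fun n => (range n).image (Nat.cast : ℕ → ZMod m)
  have cardI : ∀ {n : ℕ}, n ≤ m → #(I n) = n := by
    intro n hn
    rw [card_image_of_injOn, card_range]
    intro i hi j hj h
    rw [coe_range, Set.mem_Iio] at hi hj
    exact (cast_inj (lt_of_lt_of_le hi hn) (lt_of_lt_of_le hj hn)).1 h
  have memI : ∀ {n : ℕ} {c : ZMod m}, c ∈ I n ↔ ∃ i, i < n ∧ (i : ZMod m) = c := by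
    intro n c; simp [I]
  let full : ℕ → Finset G := fun n => univ.filter fun x => ψ x ∈ I n
  have card_full : ∀ {n : ℕ}, n ≤ m → #(full n) = n * κ := by
    intro n hn
    show #(univ.filter fun x => ψ x ∈ I n) = n * κ
    rw [card_filter_mem_eq ψ hψ (I n), cardI hn, hfib0]
  let emb : ψ.ker ↪ G := ⟨Subtype.val, Subtype.val_injective⟩
  let part : ℕ → Finset ψ.ker → Finset G := fun n R => (R.map emb).image fun x => g (n : ZMod m) + x
  have card_part : ∀ (n : ℕ) (R : Finset ψ.ker), #(part n R) = #R := by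
    intro n R
    show #((R.map emb).image fun x => g (n : ZMod m) + x) = #R
    rw [card_image_of_injective _ (add_right_injective _), card_map]
  have mem_part : ∀ {n : ℕ} {R : Finset ψ.ker} {x : G},
      x ∈ part n R ↔ ∃ p ∈ R, x = g (n : ZMod m) + (p : G) := by
    intro n R x
    simp only [part, mem_image, mem_map, emb, Function.Embedding.coeFn_mk]
    constructor
    · rintro ⟨y, ⟨p, hp, rfl⟩, rfl⟩; exact ⟨p, hp, rfl⟩
    · rintro ⟨p, hp, rfl⟩; exact ⟨p, ⟨p, hp, rfl⟩, rfl⟩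
  have ψ_part : ∀ {n : ℕ} {R : Finset ψ.ker} {x : G}, x ∈ part n R → ψ x = (n : ZMod m) := by
    intro n R x hx
    obtain ⟨p, _, rfl⟩ := mem_part.1 hx
    rw [map_add, hg, (AddMonoidHom.mem_ker).1 p.2, add_zero]
  have ψ_full : ∀ {n : ℕ} {x : G}, x ∈ full n → ∃ i, i < n ∧ ψ x = (i : ZMod m) := by
    intro n x hx
    have hx' : ψ x ∈ I n := (mem_filter.1 hx).2
    obtain ⟨i, hi, h⟩ := memI.1 hx'
    exact ⟨i, hi, h.symm⟩
  have disj : ∀ {n : ℕ} (R : Finset ψ.ker), n + 1 ≤ m → Disjoint (full n) (part n R) := by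
    intro n R hn
    rw [disjoint_left]
    intro x hxf hxp
    obtain ⟨i, hi, hψx⟩ := ψ_full hxf
    have h2 := ψ_part hxp
    rw [hψx] at h2
    have := (cast_inj (by omega) (by omega)).1 h2
    omega
  refine ⟨fun n R => full n ∪ part n R, ?_, ?_⟩
  · intro n R hn
    show #(full n ∪ part n R) = n * κ + #R
    rw [card_union_of_disjoint (disj R hn), card_full (by omega), card_part]
  · intro k l P Q hk hkm hl hlm
    show #(full (k - 1) ∪ part (k - 1) P + (full (l - 1) ∪ part (l - 1) Q)) ≤ (k + l - 2) * κ + #(P + Q)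
    let T : Finset G :=
      ((P + Q).map emb).image fun x => (g ((k - 1 : ℕ) : ZMod m) + g ((l - 1 : ℕ) : ZMod m)) + x
    have cardT : #T ≤ #(P + Q) := by
      refine card_image_le.trans ?_
      rw [card_map]
    have card_fullkl : #(full (k + l - 2)) ≤ (k + l - 2) * κ := by
      show #(univ.filter fun x => ψ x ∈ I (k + l - 2)) ≤ (k + l - 2) * κ
      rw [card_filter_mem_eq ψ hψ (I (k + l - 2)), hfib0]
      exact Nat.mul_le_mul_right _ (card_image_le.trans (card_range _).le)
    have hsub : full (k - 1) ∪ part (k - 1) P + (full (l - 1) ∪ part (l - 1) Q) ⊆ full (k + l - 2) ∪ T := by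
      intro z hz
      rw [mem_add] at hz
      obtain ⟨x, hx, y, hy, rfl⟩ := hz
      rw [mem_union] at hx hy ⊢
      have to_full : ∀ {i j : ℕ}, i + j < k + l - 2 → ψ x = (i : ZMod m) → ψ y = (j : ZMod m) →
          x + y ∈ full (k + l - 2) := by
        intro i j hij hxi hyj
        refine mem_filter.2 ⟨mem_univ _, memI.2 ⟨i + j, hij, ?_⟩⟩
        rw [map_add, hxi, hyj, Nat.cast_add]
      rcases hx with hx | hx <;> rcases hy with hy | hy
      · obtain ⟨i, hi, hxi⟩ := ψ_full hx
        obtain ⟨j, hj, hyj⟩ := ψ_full hy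
        exact Or.inl (to_full (by omega) hxi hyj)
      · obtain ⟨i, hi, hxi⟩ := ψ_full hx
        exact Or.inl (to_full (by omega) hxi (ψ_part hy))
      · obtain ⟨j, hj, hyj⟩ := ψ_full hy
        exact Or.inl (to_full (by omega) (ψ_part hx) hyj)
      · right
        obtain ⟨p, hp, rfl⟩ := mem_part.1 hx
        obtain ⟨q, hq, rfl⟩ := mem_part.1 hy
        simp only [T, mem_image, mem_map, emb, Function.Embedding.coeFn_mk]
        refine ⟨(p : G) + (q : G), ⟨p + q, add_mem_add hp hq, rfl⟩, ?_⟩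
        abel
    calc #(full (k - 1) ∪ part (k - 1) P + (full (l - 1) ∪ part (l - 1) Q))
        ≤ #(full (k + l - 2) ∪ T) := card_le_card hsub
      _ ≤ #(full (k + l - 2)) + #T := card_union_le _ _
      _ ≤ (k + l - 2) * κ + #(P + Q) := add_le_add card_fullkl cardT

/-- **Small sumsets property, one set (`ρ⁺_G(r) ≤ 2r − 1`)**: for `1 ≤ r ≤ |G|` in a finite abelian group there is `A`
with `|A| = r` and `|A + A| ≤ 2r − 1` (the `d = 1` term of `ρ⁺_G(r) = μ_G(r, r)`).  Same induction as
`exists_card_add_le_add_sub_one`, with one set. [cite: Lee2018, Thm 1 (Eliahou–Kervaire: ρ⁺_G(r) = μ_G(r,r))] -/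
theorem exists_card_add_self_le_two_mul_sub_one :
    ∀ (n : ℕ) (G : Type*) [AddCommGroup G] [Fintype G] [DecidableEq G], Fintype.card G = n →
      ∀ r : ℕ, 1 ≤ r → r ≤ n → ∃ A : Finset G, #A = r ∧ #(A + A) ≤ 2 * r - 1 := by
  intro n
  induction n using Nat.strong_induction_on with
  | _ n ih =>
  intro G _ _ _ hn r hr hrn
  classical
  by_cases h1 : n = 1
  · subst h1
    refine ⟨{0}, ?_, ?_⟩
    · rw [card_singleton]; omega
    · rw [singleton_add_singleton, add_zero, card_singleton]; omega
  have hn1 : 1 < n := by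
    have : 0 < Fintype.card G := Fintype.card_pos
    omega
  obtain ⟨m, ψ, hm, hψ⟩ := exists_surjective_zmod (G := G) (hn ▸ hn1)
  haveI : NeZero m := ⟨by omega⟩
  have hGκ : Fintype.card G = m * Nat.card ψ.ker := by
    have h := card_filter_mem_eq ψ hψ (univ : Finset (ZMod m))
    rw [card_fib_zero_eq, Finset.card_univ, ZMod.card] at h
    rw [← h, ← Finset.card_univ]
    congr 1; ext x; simp
  have hκpos : 0 < Nat.card ψ.ker := by
    rw [Nat.card_pos_iff]; exact ⟨⟨⟨0, (AddMonoidHom.mem_ker).2 (map_zero ψ)⟩⟩, inferInstance⟩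
  have hκn : Nat.card ψ.ker < n := by
    rw [← hn, hGκ]
    have : 1 * Nat.card ψ.ker < m * Nat.card ψ.ker := Nat.mul_lt_mul_of_pos_right hm hκpos
    omega
  obtain ⟨F, hFcard, hFadd⟩ := exists_liftSet ψ hψ
  obtain ⟨κ, hκ⟩ : ∃ κ, Nat.card ψ.ker = κ := ⟨_, rfl⟩
  rw [hκ] at hGκ hκpos hκn hFcard hFadd
  obtain ⟨k, hk⟩ : ∃ k, (r + κ - 1) / κ = k := ⟨_, rfl⟩
  have hrk : r ≤ k * κ := by
    have h1 := le_mul_ceilDiv hκpos r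
    rw [hk, Nat.mul_comm] at h1; exact h1
  have hkr : k * κ ≤ r + κ - 1 := by
    have h2 := Nat.div_mul_le_self (r + κ - 1) κ
    rw [hk] at h2; exact h2
  have hk1 : 1 ≤ k := by rw [← hk, Nat.one_le_div_iff hκpos]; omega
  have hkm : k ≤ m := by
    rw [← hk]; exact ceilDiv_le_of_le_mul hκpos (by rw [← hGκ, hn]; exact hrn)
  have hkκ : (k - 1) * κ = k * κ - κ := Nat.sub_one_mul k κ
  have hkκ' : κ ≤ k * κ := Nat.le_mul_of_pos_left κ hk1
  obtain ⟨ρ, hρ⟩ : ∃ ρ, r - (k - 1) * κ = ρ := ⟨_, rfl⟩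
  have hρ1 : 1 ≤ ρ := by omega
  have hρκ : ρ ≤ κ := by omega
  have hrρ : (k - 1) * κ + ρ = r := by omega
  haveI : Fintype ψ.ker := Fintype.ofFinite _
  have hcardK : Fintype.card ψ.ker = κ := by rw [← hκ, Nat.card_eq_fintype_card]
  obtain ⟨P, hP, hPP⟩ := ih κ hκn ψ.ker hcardK ρ hρ1 hρκ
  refine ⟨F (k - 1) P, ?_, ?_⟩
  · rw [hFcard (k - 1) P (by omega), hP]; exact hrρ
  · calc #(F (k - 1) P + F (k - 1) P) ≤ (k + k - 2) * κ + #(P + P) := hFadd k k P P hk1 hkm hk1 hkm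
      _ ≤ (k + k - 2) * κ + (2 * ρ - 1) := by omega
      _ = 2 * r - 1 := by
          have : (k + k - 2) * κ = (k - 1) * κ + (k - 1) * κ := by rw [← add_mul]; congr 1; omega
          rw [this]; omega

/-- **Small sumsets property, one set**, instance form: `∃ A, |A| = r, |A + A| ≤ 2r − 1` for `1 ≤ r ≤ |G|`.
[cite: Lee2018, Thm 1 (Eliahou–Kervaire: ρ⁺_G(r) = μ_G(r,r))] -/
theorem exists_card_add_self_le_two_mul_sub_one' [Fintype G] {r : ℕ} (hr : 1 ≤ r) (hrG : r ≤ Fintype.card G) :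
    ∃ A : Finset G, #A = r ∧ #(A + A) ≤ 2 * r - 1 :=
  exists_card_add_self_le_two_mul_sub_one _ G rfl r hr hrG

/-- **`ρ⁺_G(r) ≤ (2⌈r/d⌉ − 1)·d` for every `d ∣ |G|`** (one set: `r` elements inside the preimage of a set of `⌈r/d⌉`
cosets with small doubling in `G/H`, `|H| = d`). [cite: Lee2018, Thm 1 (Eliahou–Kervaire: ρ⁺_G(r) = μ_G(r,r))] -/
theorem exists_card_add_self_le_ekpTerm [Fintype G] {d r : ℕ} (hd : d ∣ Fintype.card G) (hr : 1 ≤ r)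
    (hrG : r ≤ Fintype.card G) : ∃ A : Finset G, #A = r ∧ #(A + A) ≤ ekpTerm d r r := by
  classical
  have hd' : d ∣ Nat.card G := by rwa [Nat.card_eq_fintype_card]
  obtain ⟨H, hH⟩ := Literature.GroupTheory.FiniteAbelian.exists_addSubgroup_card_eq_of_dvd_card G hd'
  have hdpos : 0 < d := Nat.pos_of_dvd_of_pos hd Fintype.card_pos
  let π : G →+ G ⧸ H := QuotientAddGroup.mk' H
  have hπ : Function.Surjective π := QuotientAddGroup.mk'_surjective H
  haveI : Fintype (G ⧸ H) := Fintype.ofFinite _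
  have hker : Nat.card π.ker = d := by
    rw [show π.ker = H from QuotientAddGroup.ker_mk' H, hH]
  have hfib : #(fib π 0) = d := by rw [card_fib_zero_eq, hker]
  have hQ : Fintype.card G = Fintype.card (G ⧸ H) * d := by
    have h := card_filter_mem_eq π hπ (univ : Finset (G ⧸ H))
    rw [hfib, card_univ] at h
    rw [← h]
    simp
  set k := (r + d - 1) / d with hk
  have hk1 : 1 ≤ k := by rw [hk, Nat.one_le_div_iff hdpos]; omega
  have hkQ : k ≤ Fintype.card (G ⧸ H) := ceilDiv_le_of_le_mul hdpos (by rw [← hQ]; exact hrG)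
  obtain ⟨A', hA', hA'A'⟩ := exists_card_add_self_le_two_mul_sub_one' (G := G ⧸ H) hk1 hkQ
  have hrA : r ≤ #(univ.filter fun x => π x ∈ A') := by
    rw [card_filter_mem_eq π hπ A', hfib, hA', Nat.mul_comm]
    exact le_mul_ceilDiv hdpos r
  obtain ⟨A, hA, hAcard⟩ := exists_subset_card_eq hrA
  refine ⟨A, hAcard, ?_⟩
  have hsub : A + A ⊆ univ.filter fun x => π x ∈ A' + A' := by
    intro z hz
    rw [mem_add] at hz
    obtain ⟨x, hx, y, hy, rfl⟩ := hz
    have hx' := (mem_filter.1 (hA hx)).2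
    have hy' := (mem_filter.1 (hA hy)).2
    exact mem_filter.2 ⟨mem_univ _, by rw [map_add]; exact add_mem_add hx' hy'⟩
  calc #(A + A) ≤ #(univ.filter fun x => π x ∈ A' + A') := card_le_card hsub
    _ = #(A' + A') * d := by rw [card_filter_mem_eq π hπ (A' + A'), hfib]
    _ ≤ (2 * k - 1) * d := Nat.mul_le_mul_right _ hA'A'
    _ = ekpTerm d r r := by rw [ekpTerm_eq_sub_one_mul]; congr 1; omega

/-- **`ρ⁺_G(r) = μ_G(r, r)` (Eliahou–Kervaire; Lee 2018, Thm 1): in every finite abelian group and for every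
`1 ≤ r ≤ |G|` some `A` with `|A| = r` has `|A + A| = ekpMu |G| r r`** (and no non-empty `A` has fewer, by
`ekpMu_le_card_add`).  CONTRAST (Lee 2018, Remark 2; not formalised): the difference analogue
`ρ⁻_G(r) = min |A − A|` can be larger than `μ_G(r,r)` outside cyclic groups.
[cite: Lee2018, Thm 1 (Eliahou–Kervaire: ρ⁺_G(r) = μ_G(r,r))] -/
theorem exists_card_add_self_eq_ekpMu [Fintype G] {r : ℕ} (hr : 1 ≤ r) (hrG : r ≤ Fintype.card G) :
    ∃ A : Finset G, #A = r ∧ #(A + A) = ekpMu (Fintype.card G) r r := by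
  have hn : Fintype.card G ≠ 0 := Fintype.card_ne_zero
  obtain ⟨d, hd, hdpos, hmu⟩ := exists_dvd_ekpMu_eq hn r r
  obtain ⟨A, hA, hle⟩ := exists_card_add_self_le_ekpTerm hd hr hrG
  refine ⟨A, hA, le_antisymm (hmu ▸ hle) ?_⟩
  have hAne : A.Nonempty := card_pos.1 (by omega)
  have h := ekpMu_le_card_add hAne hAne
  rwa [hA] at h

end Diagonal

/-! ## Few differences: the coset-progression upper bound for `ρ⁻_G(r)` in any finite abelian group
(Lee 2018, Thm "upper bound", construction of §3 — subgroup form) — appended gen 9 -/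

section FewDifferences

variable {G : Type*} [AddCommGroup G] [DecidableEq G]

/-- **Coset-progression upper bound for the one-set difference function (Lee 2018, §3, subgroup form).**  Let `H`
be a subgroup of the finite abelian group `G` and `g ∈ G` an element whose class in `G/H` has order at least
`c ≥ 1`.  Then for every `r ≤ c·|H|` there is `S ⊆ G` with `|S| = r` and `|S − S| ≤ (2c − 1)·|H|`: take `S` inside the
`c` cosets `i·g + H`, `i < c` (they are distinct), whose pairwise differences lie in the `2c − 1` cosets
`e·g + H`, `|e| < c`.  For `G = ℤ/n`, `|H| = d`, `g = 1`, `c = ⌈r/d⌉` this is `exists_card_sub_self_le_zmod`; Lee's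
printed form `ρ⁻_G(r) ≤ min_{d ∈ D(N,e,r)} d(2⌈r/d⌉ − 1)` (`e = exp G`) is this statement for the subgroups
`A₁ × dℤ/e ≤ H′ × ℤ/e ≅ G` of his proof (the printed form, via the splitting `G ≅ ℤ/e × H′` of
`Literature/GroupTheory/FiniteAbelian/MaximalOrderSummand`, is `exists_card_sub_self_le_of_dvd_exponent` below); equality
(his Conjecture 1) is printed as OPEN except for cyclic groups and `(ℤ/p)^d`.
[cite: Lee2018, Thm (upper bound) — §3 construction] -/
theorem exists_card_sub_self_le_of_addSubgroup [Fintype G] (H : AddSubgroup G) (g : G) {c r : ℕ} (hc : 1 ≤ c)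
    (hord : c ≤ addOrderOf (QuotientAddGroup.mk' H g)) (hr : r ≤ c * Nat.card H) :
    ∃ S : Finset G, #S = r ∧ #(S - S) ≤ (2 * c - 1) * Nat.card H := by
  classical
  let π : G →+ G ⧸ H := QuotientAddGroup.mk' H
  have hπ : Function.Surjective π := QuotientAddGroup.mk'_surjective H
  haveI : Fintype (G ⧸ H) := Fintype.ofFinite _
  have hfib : #(fib π 0) = Nat.card H := by
    rw [card_fib_zero_eq, show π.ker = H from QuotientAddGroup.ker_mk' H]
  set x : G ⧸ H := π g with hx
  -- the progression `P = {0, x, …, (c−1)x}` has `c` elements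
  let P : Finset (G ⧸ H) := (range c).image fun i => i • x
  have hPcard : #P = c := by
    show #((range c).image fun i => i • x) = c
    rw [card_image_of_injOn, card_range]
    intro i hi j hj h
    rw [coe_range, Set.mem_Iio] at hi hj
    exact nsmul_injOn_Iio_addOrderOf (Set.mem_Iio.2 (lt_of_lt_of_le hi hord))
      (Set.mem_Iio.2 (lt_of_lt_of_le hj hord)) h
  -- its difference set lies in `{e • x : -(c-1) ≤ e < c}`
  let D : Finset (G ⧸ H) := (Finset.Ico (-((c : ℤ) - 1)) (c : ℤ)).image fun e => e • x
  have hDcard : #D ≤ 2 * c - 1 := by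
    refine card_image_le.trans ?_
    rw [Int.card_Ico]
    omega
  have hPD : P - P ⊆ D := by
    intro z hz
    rw [mem_sub] at hz
    obtain ⟨u, hu, v, hv, rfl⟩ := hz
    simp only [P, mem_image, mem_range] at hu hv
    obtain ⟨i, hi, rfl⟩ := hu
    obtain ⟨j, hj, rfl⟩ := hv
    simp only [D, mem_image, Finset.mem_Ico]
    refine ⟨(i : ℤ) - (j : ℤ), ⟨by omega, by omega⟩, ?_⟩
    rw [sub_zsmul, natCast_zsmul, natCast_zsmul, sub_eq_add_neg]
  -- `S` = any `r` elements of the preimage of `P`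
  have hrF : r ≤ #(univ.filter fun y => π y ∈ P) := by
    rw [card_filter_mem_eq π hπ P, hfib, hPcard]; exact hr
  obtain ⟨S, hS, hScard⟩ := exists_subset_card_eq hrF
  refine ⟨S, hScard, ?_⟩
  have hsub : S - S ⊆ univ.filter fun y => π y ∈ D := by
    intro z hz
    rw [mem_sub] at hz
    obtain ⟨u, hu, v, hv, rfl⟩ := hz
    have hu' := (mem_filter.1 (hS hu)).2
    have hv' := (mem_filter.1 (hS hv)).2
    exact mem_filter.2 ⟨mem_univ _, by rw [map_sub]; exact hPD (sub_mem_sub hu' hv')⟩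
  calc #(S - S) ≤ #(univ.filter fun y => π y ∈ D) := card_le_card hsub
    _ = #D * Nat.card H := by rw [card_filter_mem_eq π hπ D, hfib]
    _ ≤ (2 * c - 1) * Nat.card H := Nat.mul_le_mul_right _ hDcard

end FewDifferences

/-! ## Lee's upper bound in the printed `D(N, e, r)` form (appended 2026-08-27, gen 10) -/

section PrintedUpperBound

variable {G : Type*} [AddCommGroup G] [DecidableEq G]

/-- In `ℤ/e`, for `q ∣ e`, the class of `k` with `0 < k < q` is not a multiple of the class of `q`. [folklore] -/
private theorem natCast_not_mem_zmultiples {e q k : ℕ} (hqe : q ∣ e) (hk : 0 < k) (hkq : k < q) :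
    ((k : ℕ) : ZMod e) ∉ AddSubgroup.zmultiples ((q : ℕ) : ZMod e) := by
  intro h
  rw [AddSubgroup.mem_zmultiples_iff] at h
  obtain ⟨z, hz⟩ := h
  have hz' : (((z * q - k : ℤ)) : ZMod e) = 0 := by
    push_cast
    rw [← hz, zsmul_eq_mul]
    ring
  rw [ZMod.intCast_zmod_eq_zero_iff_dvd] at hz'
  have hq : (q : ℤ) ∣ (k : ℤ) := by
    have h1 : (q : ℤ) ∣ z * q - k := dvd_trans (Int.natCast_dvd_natCast.2 hqe) hz'
    have h2 : (q : ℤ) ∣ z * q := dvd_mul_left _ _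
    have := dvd_sub h2 h1
    rwa [sub_sub_cancel] at this
  have := Int.le_of_dvd (by exact_mod_cast hk) hq
  omega

/-- An injective additive map preserves `|S − S|`. [folklore] -/
private theorem card_sub_image_eq {H : Type*} [AddCommGroup H] [DecidableEq H] {F : Type*} [FunLike F H G]
    [AddMonoidHomClass F H G] (f : F) (hf : Function.Injective f) (S : Finset H) :
    #(S.image f - S.image f) = #(S - S) := by
  have h : (S - S).image f = S.image f - S.image f := image_image₂_distrib (map_sub f)
  rw [← h, card_image_of_injective _ hf]

/-- **Lee 2018, Theorem "upper bound" AS PRINTED (cf. Bajnok–Matzke).**  Let `G` be a finite abelian group of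
order `N` and exponent `e`.  For `d₁ ∣ N/e`, `d₂ ∣ e` and `r ≤ d₁ e` (i.e. `d = d₁ d₂ ∈ D(N, e, r)`) there is
`S ⊆ G` with `|S| = r` and `|S − S| ≤ d (2⌈r/d⌉ − 1)`; hence `ρ⁻_G(r) ≤ min_{d ∈ D(N,e,r)} d (2⌈r/d⌉ − 1)`.
Proof as printed: `G ≅ ℤ/e × H` (the tree's `exists_addEquiv_zmod_exponent_prod`, Hungerford II §2 Ex. 2),
`A₁ ≤ H` of order `d₁` (converse of Lagrange), and a coset progression of `⌈r/d⌉ ≤ e/d₂` cosets of the subgroup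
`A₁ × (e/d₂)ℤ/e` of order `d` (`exists_card_sub_self_le_of_addSubgroup`).  Equality is Lee's Conjecture 1
(printed open outside cyclic groups and `(ℤ/p)^d`). [cite: Lee2018, Thm (upper bound), §3] -/
theorem exists_card_sub_self_le_of_dvd_exponent [Fintype G] {r d₁ d₂ : ℕ}
    (hd₁ : d₁ ∣ Fintype.card G / AddMonoid.exponent G) (hd₂ : d₂ ∣ AddMonoid.exponent G)
    (hr : r ≤ d₁ * AddMonoid.exponent G) :
    ∃ S : Finset G, #S = r ∧ #(S - S) ≤ (d₁ * d₂) * (2 * ((r + d₁ * d₂ - 1) / (d₁ * d₂)) - 1) := by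
  classical
  set e := AddMonoid.exponent G with he_def
  have he : 0 < e := (AddMonoid.ExponentExists.of_finite (G := G)).exponent_pos
  haveI : NeZero e := ⟨he.ne'⟩
  -- the splitting `G ≅ ℤ/e × K`
  obtain ⟨K, ⟨φ⟩⟩ := Literature.GroupTheory.FiniteAbelian.exists_addEquiv_zmod_exponent_prod G
  have hK : Nat.card K = Fintype.card G / e := by
    have h := Nat.card_congr φ.toEquiv
    rw [Nat.card_prod, Nat.card_zmod, Nat.card_eq_fintype_card] at h
    rw [h, Nat.mul_div_cancel_left _ he]
  -- the degenerate cases `d₁ = 0`, `d₂ = 0`, `r = 0`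
  have hN : 0 < Fintype.card G := Fintype.card_pos
  have hd₁pos : 0 < d₁ := by
    rcases Nat.eq_zero_or_pos d₁ with h0 | h0
    · exfalso
      rw [h0, zero_dvd_iff] at hd₁
      have : e ∣ Fintype.card G := by
        rw [he_def, ← Nat.card_eq_fintype_card]
        exact AddGroup.exponent_dvd_nat_card
      have := Nat.div_pos (Nat.le_of_dvd hN this) he
      omega
    · exact h0
  have hd₂pos : 0 < d₂ := Nat.pos_of_dvd_of_pos hd₂ he
  set d := d₁ * d₂ with hd
  have hdpos : 0 < d := Nat.mul_pos hd₁pos hd₂pos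
  rcases Nat.eq_zero_or_pos r with hr0 | hrpos
  · exact ⟨∅, by simp [hr0], by simp⟩
  -- the subgroup `B × A₁` of `ℤ/e × K` of order `d₂ d₁`
  obtain ⟨A₁, hA₁⟩ := Literature.GroupTheory.FiniteAbelian.exists_addSubgroup_card_eq_of_dvd_card K
    (show d₁ ∣ Nat.card K by rw [hK]; exact hd₁)
  set q := e / d₂ with hq
  have hqd₂ : q * d₂ = e := Nat.div_mul_cancel hd₂
  have hqpos : 0 < q := Nat.div_pos (Nat.le_of_dvd he hd₂) hd₂pos
  have hqe : q ∣ e := ⟨d₂, hqd₂.symm⟩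
  let B : AddSubgroup (ZMod e) := AddSubgroup.zmultiples ((q : ℕ) : ZMod e)
  have hB : Nat.card B = d₂ := Literature.GroupTheory.FiniteAbelian.natCard_zmultiples_natCast_div he hd₂
  let H' : AddSubgroup (ZMod e × K) := B.prod A₁
  have hH' : Nat.card H' = d := by
    rw [Nat.card_congr (AddSubgroup.prodEquiv B A₁).toEquiv, Nat.card_prod, hB, hA₁, hd, mul_comm]
  -- the order of `(1, 0)` modulo `H'` is `q = e/d₂`
  let g : ZMod e × K := (1, 0)
  have hnsmul : ∀ k : ℕ, k • g = ((k : ZMod e), 0) := fun k => by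
    ext <;> simp [g]
  have hord : addOrderOf (QuotientAddGroup.mk' H' g) = q := by
    rw [addOrderOf_eq_iff hqpos]
    constructor
    · rw [← map_nsmul, hnsmul, QuotientAddGroup.mk'_apply, QuotientAddGroup.eq_zero_iff, AddSubgroup.mem_prod]
      exact ⟨AddSubgroup.mem_zmultiples _, zero_mem _⟩
    · intro k hkq hk h
      rw [← map_nsmul, hnsmul, QuotientAddGroup.mk'_apply, QuotientAddGroup.eq_zero_iff, AddSubgroup.mem_prod] at h
      exact natCast_not_mem_zmultiples hqe hk hkq h.1
  -- the number of cosets `c = ⌈r/d⌉ ≤ q`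
  set c := (r + d - 1) / d with hc
  have hc1 : 1 ≤ c := by
    rw [hc, Nat.le_div_iff_mul_le hdpos]; omega
  have hcq : c ≤ q := by
    rw [hc, ← Nat.lt_add_one_iff, Nat.div_lt_iff_lt_mul hdpos]
    have : r ≤ q * d := by
      rw [hd, mul_comm d₁ d₂, ← mul_assoc, hqd₂, mul_comm]; exact hr
    have : (q + 1) * d = q * d + d := by ring
    omega
  have hrc : r ≤ c * Nat.card H' := by
    rw [hH', hc]
    have := (Nat.lt_add_one_iff.symm.trans (Nat.div_lt_iff_lt_mul hdpos)).1 (le_refl ((r + d - 1) / d))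
    -- `r + d − 1 < (c + 1) d`
    have e1 : ((r + d - 1) / d + 1) * d = (r + d - 1) / d * d + d := by ring
    omega
  -- Lee's coset progression in `ℤ/e × K`, pulled back to `G`
  haveI : Fintype (ZMod e × K) := Fintype.ofFinite _
  obtain ⟨S', hS', hS'S'⟩ := exists_card_sub_self_le_of_addSubgroup H' g hc1 (by rw [hord]; exact hcq) hrc
  refine ⟨S'.image φ.symm, by rw [card_image_of_injective _ φ.symm.injective, hS'], ?_⟩
  rw [card_sub_image_eq φ.symm φ.symm.injective, mul_comm]
  rw [hH'] at hS'S'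
  exact hS'S'

end PrintedUpperBound

end Literature.Combinatorics.Additive
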